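import Summits.QuantumFields.YangMills.Theorems.BalabanUVNodesN15TwoSpacingGluingCurvedCoverLift
import HarnessLib

/-!
# THE GLUING STEP AT TWO LATTICE SPACINGS — (Γ15) THE LIVE-`U` KNIT AT THE COVER, III: THE OBJECTS — the cover's cut `χ_k` (the box `c(2w,k) + [0,6w+1)`), plateau `ψ_k` (the cube),
# radius-2 bump `χ̃_k`, the flat cubes `G(□_k) ⊗ 1_ι` and nonlocal part `(aQ*Q − ∂Π∂*) ⊗ 1_ι`, the GLUED OPERATOR `cvGlued` of dag-n15-w3's dressed smooth-cut cubes for Bałaban's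
# `Δ_{R_U} + P` at a LIVE unitary bond field `U`, the window arithmetic at `L ≥ 7`, and the smallness of 52's remainder letter (every term `O(w⁻¹)` except the far `N_V` letter)
# (dag-n15-c g15, FILE 119; N15 = NE2, s1 «background-layer OPERATOR ingredient»)

Cell `pub-ymgap`, seat `pub-ymgap-dag-n15-c` (R134 (a); HUMAN RULING D-0062), generation 15.  `bears_on: R4∕N15 · K3⁸ SpineGivenEndpointR13SepCoPHV (stmt-QuantumFields-27366)`.
Filed `--supports stmt-QuantumFields-27366 --as helper` — COUNT-NEUTRAL.  Plumbing `abbrev`s∕`def`s (`cvM`, `CvX`, `cvBlk`, `CvNorm`, `cvSk`, `cvChi`, `cvPsi`, `cvBump`, `cvCube`,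
`cvNL`, ★ `cvGlued`) + theorems; 0 `sorry`.  Imports BY NAME FILE 118 `…CurvedCoverLift` (through it 117, FILE 70 `knitH`∕`knitG`∕`coverMargin`, dag-n15-w4 V–VII, dag-n15-a N-II∕N-III,
dag-n15-w3 52 `…SmoothCutDressedGluedGaugedUN` and its vocabulary `glueInv`∕`parametrix`∕`remainder`∕`bgPropV`∕`stack`∕`unstackM`∕`tCoefC`∕`tCoefA`∕`covLapM`∕`gaugePair`∕`mmulOp`∕
`coordMat`).  Nothing in the tree is modified, no landed name re-declared.

WHAT.
* §1 `two_mul_le_coverMargin` (`2w ≤ m₀` at `L ≥ 7`), `coverMargin_inner_fit` (`(m₀ − 2w) + (6w + 1) ≤ Lw`, `w ≥ 2`): the cut box sits inside the cube with margin `≈ (L−6)w∕2` both ways.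
* §2 the objects of the knit at volume exponent `m+1` (torus `2L·L^m`), spacing `L^{−k}`, per-cube gauges `u_k`, bond field `U`, summand `P`, perturbations `N_V k`, colour index `ι`;
  ★ `cvGlued` = 52's `glueInv (parametrix h (W_kᵀX_kW_k)) (remainder (Δ_{R_U} + P) h (W_kᵀX_kW_k) − Σ_k W_kᵀ(tail + far corrections)W_kM_{h_k})` with the cover's data, LITERALLY.
* §3 ★★ `cvSmall` — pure real arithmetic: with `c_t = c₁ = π∕w`, `c₂ = 32π²∕w²`, `ℓ = ω = πD∕w`, `d₁ = 1`, `θ_W = 0`, `c_N = (πD∕w·E′ + 2πD∕w)c_{N,0}`, `ε₀ ≤ κ∕w`, `(β + β₁ + (π∕w)β)Rc_r² ≤ ½`,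
  `N_ov c_r|ι|²θ_F·2(β + β₁ + πβ)c_r ≤ ¼` and `w ≥ 4N_ov c_r|ι|²(A₁ + A₂ + 2κ)`: 52's remainder letter `E` (its `hq'`, verbatim) is `< 1` AND `N_ov|ι|²B(1 − E)⁻¹c_r ≤ N_ov|ι|²·2(β + β₁ + πβ)·2·c_r`.

HONEST FRAMING ∕ LIMITS.  Definitions + arithmetic; no analytic estimate; the objects are dag-n15-w3's dressed-cube construction on the `U ≡ 1` doubled-cube torus MODEL cover of FILE 70 with
a LIVE bond field `U` as a parameter; nothing of [B5]∕[B6]∕[B9] asserted ((2.36)–(2.37) p.229, (2.91)–(2.93) p.239, (2.133)–(2.136) p.247, (3.34)–(3.35) p.396, (3.50)–(3.53) p.400,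
(3.62)–(3.65) pp.402–403, (3.76)–(3.77) p.406 = SHAPES ∕ MECHANISM).  NE2⁺ NOT PRINTED, NOT proved; N15 NOT discharged; K3⁸ OPEN, skeleton v6 untouched; counts of record UNMOVED
(typed 28∕28 · discharged 5∕27); one finite 𝕋⁴ at fixed ε — NOT infinite volume, NOT OS on ℝ⁴, NOT a mass gap, NOT Clay; R4 closes the conditional finite-𝕋⁴ rung `BalabanLadder.UV` only.
Restate-immune (no Theses import).
-/

noncomputable section

open scoped BigOperators Matrix Matrix.Norms.Frobenius

namespace Summit.QuantumFields.YangMills.BalabanUVNodes.N15.Gluing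

open Real
open Literature.MathematicalPhysics.QuantumFieldTheory.Balaban1983to89
open Literature.MathematicalPhysics.QuantumFieldTheory.Balaban1983to89.B5Prop11Plancherel (Tor fine unitVec)
open Literature.MathematicalPhysics.QuantumFieldTheory.Balaban1983to89.B11SectG (BlockNorm HasMaj RowSum)
open Literature.MathematicalPhysics.QuantumFieldTheory.Balaban1983to89.B6RandomWalk (Triangle254)
open Literature.MathematicalPhysics.QuantumFieldTheory.Balaban1983to89.B6Prop26Gluing (mulOp mulOp_apply ind ind_nonneg ind_le_one)
open Literature.MathematicalPhysics.QuantumFieldTheory.Balaban1983to89.B6UnitTorusCarrier (unitTorusGeo triangle254_unitTorusGeo rowSum_unitTorusGeo unitTorusGeo_dist_nonneg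
  unitTorusGeo_dist_symm unitTorusGeo_dist_self)
open Literature.MathematicalPhysics.QuantumFieldTheory.Balaban1983to89.B5SiteBridgeP12 (MP)
open Literature.MathematicalPhysics.QuantumFieldTheory.King1986.Torus (blockOf tdistT tdistT_nonneg tdistT_symm)
open Literature.Barriers.QuantumFields (traceForm)
open Summit.QuantumFields.YangMills.BalabanUVNodes.N15.BackgroundLayer (fgrad fgradAdj bgrad fgrad_apply fgradAdj_apply bgrad_apply stack projO bgPropV covLapM tCoefA tCoefC unstackM)
open Summit.QuantumFields.YangMills.BalabanUVNodes.N15.VectorPiece (bshiftEquiv bshiftEquiv_apply tensorId hasMaj_tensorId tdistT_blockOf_sub_unitVec_le)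
open Summit.QuantumFields.YangMills.BalabanUVNodes.N15.MatrixSpecies (mmulOp coordMat liftBlk liftEquiv liftEquiv_apply liftEquiv_symm_apply)
open Summit.QuantumFields.YangMills.BalabanUVNodes.N15.TwoGrid (paramsOf symbOp sD landauRe qvRe qvAdjRe gOp neumannCubeG chiCube cubeBlocks ineq110_114_pair hasMaj_gOp_of_ineq hasMaj_grad_of_ineq
  hasMaj_landauRe chiCube_of_not_mem abs_chiCube_le_one)
open Summit.QuantumFields.YangMills.BalabanUVNodes.N15.CurvedSpecies (gaugePair uN_hasMaj_glueInv_smoothCutDressed_localGauges uN_glueInv_smoothCutDressed_localGauges_inverse)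

variable {d : ℕ}

/-! ## §1 The window arithmetic of the cover at `L ≥ 7`, radius `R = 2` -/

section Params

variable {L : ℕ}

/-- `2w ≤ m₀` (`w = L^m`, `L ≥ 7`): the cut box `c(2w,k) + [0, 6w+1)` sits `m₀ − 2w ≥ 0` blocks above the cube's corner. [folklore] -/
theorem two_mul_le_coverMargin (hL7 : 7 ≤ L) (m : ℕ) : 2 * L ^ m ≤ coverMargin L m := by
  unfold coverMargin
  have h7 : 7 * L ^ m ≤ L * L ^ m := Nat.mul_le_mul_right _ hL7
  have hsub : (L - 2) * L ^ m = L * L ^ m - 2 * L ^ m := Nat.sub_mul L 2 (L ^ m)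
  rw [hsub]
  omega

/-- `(m₀ − 2w) + (6w + 1) ≤ Lw`: the cut box lies inside the cube (`w ≥ 2`, `L ≥ 7`). [folklore] -/
theorem coverMargin_inner_fit (hL7 : 7 ≤ L) {m : ℕ} (hw : 2 ≤ L ^ m) : (coverMargin L m - 2 * L ^ m) + (6 * L ^ m + 1) ≤ L * L ^ m := by
  unfold coverMargin
  have h7 : 7 * L ^ m ≤ L * L ^ m := Nat.mul_le_mul_right _ hL7
  have hsub : (L - 2) * L ^ m = L * L ^ m - 2 * L ^ m := Nat.sub_mul L 2 (L ^ m)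
  rw [hsub]
  omega

end Params

/-! ## §2 The objects of the live-`U` knit at the cover -/

section Objects

variable (d) (L : ℕ) [NeZero L]

/-- the doubled torus `M_ν = 2L·L^{m}` of the cover (dag-n15-a's `MP (paramsOf d L (m+1) k hL)`). [folklore] -/
abbrev cvM (mv kk : ℕ) (hL : Odd L ∧ 1 < L) : Fin (d + 1) → ℕ := MP (paramsOf d L (mv + 1) kk hL)

/-- the bond carrier at spacing `L^{−k}` on the doubled torus. [folklore] -/
abbrev CvX (mv kk : ℕ) (hL : Odd L ∧ 1 < L) : Type := Tor (fine (L ^ kk) (cvM d L mv kk hL)) × Fin (d + 1)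

/-- the coarse block map of the bond carrier (unit blocks). [folklore] -/
abbrev cvBlk (mv kk : ℕ) (hL : Odd L ∧ 1 < L) : CvX d L mv kk hL → Tor (cvM d L mv kk hL) := fun b => blockOf (L ^ kk) (cvM d L mv kk hL) b.1

/-- the sharp block norm of the coloured bond carrier `(Tor × Fin (d+1)) × ι` (dag-n15-w3's `BlockNorm.ofBlocks g (liftBlk blk ι)`). [folklore] -/
abbrev CvNorm (mv kk : ℕ) (hL : Odd L ∧ 1 < L) (ι : Type) [Fintype ι] : BlockNorm (unitTorusGeo L kk (cvM d L mv kk hL)) (CvX d L mv kk hL × ι → ℝ) :=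
  BlockNorm.ofBlocks (unitTorusGeo L kk (cvM d L mv kk hL)) (liftBlk (cvBlk d L mv kk hL) ι)

/-- the blocks of the cube `□_k` of the cover (FILE 70's `knitG` cube: corner `c(m₀, k)`, side `L·L^m`). [cite: Balaban1984PropagatorsII, (2.37) p.229 (shape)] -/
abbrev cvSk (mv kk : ℕ) (hL : Odd L ∧ 1 < L) (k : Fin (d + 1) → ZMod (2 * L)) : Set (Tor (cvM d L mv kk hL)) :=
  ((cubeBlocks (cvM d L mv kk hL) (coverCorner (cvM d L mv kk hL) (L ^ mv) L (coverMargin L mv) k) (L * L ^ mv) : Finset (Tor (cvM d L mv kk hL))) : Set (Tor (cvM d L mv kk hL)))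

/-- THE INPUT CUT `χ_k`: the indicator of the blocks of the box `c(2w, k) + [0, 6w+1)^{d+1}` (`w = L^m`) — `1` one step around the support of the radius-2 bump, inside the cube.
[cite: Balaban1985BackgroundPropagators, (3.62)–(3.65) pp.402–403 (nested cut-offs: shape)] -/
abbrev cvChi (mv kk : ℕ) (hL : Odd L ∧ 1 < L) (k : Fin (d + 1) → ZMod (2 * L)) : CvX d L mv kk hL → ℝ :=
  chiCube (cvM d L mv kk hL) (L ^ kk) (coverCorner (cvM d L mv kk hL) (L ^ mv) L (2 * L ^ mv) k) (6 * L ^ mv + 1)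

/-- THE PLATEAU `ψ_k`: the indicator of the blocks of the cube `□_k = c(m₀, k) + [0, Lw)^{d+1}` itself. [cite: Balaban1984PropagatorsII, (2.37) p.229 (shape)] -/
abbrev cvPsi (mv kk : ℕ) (hL : Odd L ∧ 1 < L) (k : Fin (d + 1) → ZMod (2 * L)) : CvX d L mv kk hL → ℝ :=
  chiCube (cvM d L mv kk hL) (L ^ kk) (coverCorner (cvM d L mv kk hL) (L ^ mv) L (coverMargin L mv) k) (L * L ^ mv)

/-- THE SMOOTH CUT `χ̃_k`: dag-n15-w4's radius-2 bump on the cover's coordinates. [cite: Balaban1985BackgroundPropagators, (3.62)–(3.65) pp.402–403 (shape)] -/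
abbrev cvBump (mv kk : ℕ) (hL : Odd L ∧ 1 < L) (k : Fin (d + 1) → ZMod (2 * L)) : CvX d L mv kk hL → ℝ :=
  bcube (2 * L) (coverXi (cvM d L mv kk hL) (L ^ kk) (L ^ mv)) 2 k

/-- THE FLAT CUBE OPERATOR `N_k = G(□_k) ⊗ 1_ι` (FILE 70's Neumann cube of the cover, componentwise in the colour). [cite: Balaban1984PropagatorsII, (2.37) p.229, (2.156) p.250 (shape)] -/
def cvCube (mv kk : ℕ) (hL : Odd L ∧ 1 < L) (a : ℝ) (ι : Type) (k : Fin (d + 1) → ZMod (2 * L)) : (CvX d L mv kk hL × ι → ℝ) →ₗ[ℝ] (CvX d L mv kk hL × ι → ℝ) :=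
  tensorId ι (knitG d L mv kk (L ^ kk) hL a k)

/-- THE FLAT NONLOCAL PART `N_L = (aQ*Q − ∂Π∂*) ⊗ 1_ι`. [cite: Balaban1984PropagatorsI, (1.69) p.29 (shape)] -/
def cvNL (mv kk : ℕ) (hL : Odd L ∧ 1 < L) (a : ℝ) (ι : Type) : (CvX d L mv kk hL × ι → ℝ) →ₗ[ℝ] (CvX d L mv kk hL × ι → ℝ) :=
  tensorId ι (a • (qvAdjRe (cvM d L mv kk hL) (L ^ kk) ∘ₗ qvRe (cvM d L mv kk hL) (L ^ kk)) + (-landauRe (cvM d L mv kk hL) (L ^ kk)))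

/-- ★ **THE   (glueInv (parametrix (fun k (p : CvX d L mv kk hL × ι) => knitH d L mv kk (L ^ kk) hL k p.1) (fun k => mmulOp (fun x => (coordMat e (ContinuousLinearMap.mulLeftRight ℝ (Matrix mm mm ℂ) (u k x) (u k x)ᴴ))ᵀ) ∘ₗ (projO none ∘ₗ bgPropV (stack (mulOp (fun p : CvX d L mv kk hL × ι => cvBump d L mv kk hL k p.1) ∘ₗ cvCube d L mv kk hL a ι k) (fun j => Sum.elim (fun μ => fgrad η⁻¹ (liftEquiv (bshiftEquiv (cvM d L mv kk hL) (L ^ kk) μ) ι)) (fun μ => bgrad η⁻¹ (liftEquiv (bshiftEquiv (cvM d L mv kk hL) (L ^ kk) μ) ι)) j ∘ₗ (mulOp (fun p : CvX d L mv kk hL × ι => cvBump d L mv kk hL k p.1) ∘ₗ cvCube d L mv kk hL a ι k))) (mulOp (fun p : CvX d L mv kk hL × ι => cvPsi d L mv kk hL k p.1) ∘ₗ (unstackM (tCoefC η (gaugePair (bshiftEquiv (cvM d L mv kk hL) (L ^ kk)) fun μ x => coordMat e (ContinuousLinearMap.mulLeftRight ℝ (Matrix mm mm ℂ) (u k x *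 U μ x * (u k (bshiftEquiv (cvM d L mv kk hL) (L ^ kk) μ x))ᴴ) (u k x * U μ x * (u k (bshiftEquiv (cvM d L mv kk hL) (L ^ kk) μ x))ᴴ)ᴴ)))
  (tCoefA η (gaugePair (bshiftEquiv (cvM d L mv kk hL) (L ^ kk)) fun μ x => coordMat e (ContinuousLinearMap.mulLeftRight ℝ (Matrix mm mm ℂ) (u k x * U μ x * (u k (bshiftEquiv (cvM d L mv kk hL) (L ^ kk) μ x))ᴴ) (u k x * U μ x * (u k (bshiftEquiv (cvM d L mv kk hL) (L ^ kk) μ x))ᴴ)ᴴ))) + NV k ∘ₗ projO none) ∘ₗ mulOp (fun q : (CvX d L mv kk hL × ι) × Option (Fin (d + 1) ⊕ Fin (d + 1)) => cvChi d L mv kk hL k q.1.1))) ∘ₗ mmulOp (fun x => coordMat e (ContinuousLinearMap.mulLeftRight ℝ (Matrix mm mm ℂ) (u k x) (u k x)ᴴ))))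
  (remainder (covLapM (bshiftEquiv (cvM d L mv kk hL) (L ^ kk)) η (gaugePair (bshiftEquiv (cvM d L mv kk hL) (L ^ kk)) (fun μ x => coordMat e (ContinuousLinearMap.mulLeftRight ℝ (Matrix mm mm ℂ) (U μ x) (U μ x)ᴴ))) + P) (fun k (p : CvX d L mv kk hL × ι) => knitH d L mv kk (L ^ kk) hL k p.1) (fun k => mmulOp (fun x => (coordMat e (ContinuousLinearMap.mulLeftRight ℝ (Matrix mm mm ℂ) (u k x) (u k x)ᴴ))ᵀ) ∘ₗ (projO none ∘ₗ bgPropV (stack (mulOp (fun p : CvX d L mv kk hL × ι => cvBump d L mv kk hL k p.1) ∘ₗ cvCube d L mv kk hL a ι k) (fun j => Sum.elim (fun μ => fgrad η⁻¹ (liftEquiv (bshiftEquiv (cvM d L mv kk hL) (L ^ kk) μ) ι)) (fun μ => bgrad η⁻¹ (liftEquiv (bshiftEquiv (cvM d L mv kk hL) (L ^ kk) μ) ι)) j ∘ₗ (mulOp (fun p : CvX d L mv kk hL × ι => cvBump d L mv kk hL k p.1) ∘ₗ cvCube d L mv kk hL a ι k))) (mulOp (fun p : CvX d L mv kk hL ×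 ι => cvPsi d L mv kk hL k p.1) ∘ₗ (unstackM (tCoefC η (gaugePair (bshiftEquiv (cvM d L mv kk hL) (L ^ kk)) fun μ x => coordMat e (ContinuousLinearMap.mulLeftRight ℝ (Matrix mm mm ℂ) (u k x * U μ x * (u k (bshiftEquiv (cvM d L mv kk hL) (L ^ kk) μ x))ᴴ) (u k x * U μ x * (u k (bshiftEquiv (cvM d L mv kk hL) (L ^ kk) μ x))ᴴ)ᴴ)))
  (tCoefA η (gaugePair (bshiftEquiv (cvM d L mv kk hL) (L ^ kk)) fun μ x => coordMat e (ContinuousLinearMap.mulLeftRight ℝ (Matrix mm mm ℂ) (u k x * U μ x * (u k (bshiftEquiv (cvM d L mv kk hL) (L ^ kk) μ x))ᴴ) (u k x * U μ x * (u k (bshiftEquiv (cvM d L mv kk hL) (L ^ kk) μ x))ᴴ)ᴴ))) + NV k ∘ₗ projO none) ∘ₗ mulOp (fun q : (CvX d L mv kk hL × ι) × Option (Fin (d + 1) ⊕ Fin (d + 1)) => cvChi d L mv kk hL k q.1.1))) ∘ₗ mmulOp (fun x => coordMat e (ContinuousLinearMap.mulLeftRight ℝ (Matrix mm mm ℂ)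 (u k x) (u k x)ᴴ))) -
  ∑ k, (mmulOp (fun x => (coordMat e (ContinuousLinearMap.mulLeftRight ℝ (Matrix mm mm ℂ) (u k x) (u k x)ᴴ))ᵀ) ∘ₗ ((((-(mulOp (fun p : CvX d L mv kk hL × ι => knitH d L mv kk (L ^ kk) hL k p.1) ∘ₗ cvNL d L mv kk hL a ι ∘ₗ mulOp (1 - fun p : CvX d L mv kk hL × ι => cvBump d L mv kk hL k p.1))) ∘ₗ cvCube d L mv kk hL a ι k) ∘ₗ (LinearMap.id + ((mulOp (fun p : CvX d L mv kk hL × ι => cvPsi d L mv kk hL k p.1) ∘ₗ (unstackM (tCoefC η (gaugePair (bshiftEquiv (cvM d L mv kk hL) (L ^ kk)) fun μ x => coordMat e (ContinuousLinearMap.mulLeftRight ℝ (Matrix mm mm ℂ) (u k x * U μ x * (u k (bshiftEquiv (cvM d L mv kk hL) (L ^ kk) μ x))ᴴ) (u k x * U μ x * (u k (bshiftEquiv (cvM d L mv kk hL) (L ^ kk) μ x))ᴴ)ᴴ)))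
  (tCoefA η (gaugePair (bshiftEquiv (cvM d L mv kk hL) (L ^ kk)) fun μ x => coordMat e (ContinuousLinearMap.mulLeftRight ℝ (Matrix mm mm ℂ) (u k x * U μ x * (u k (bshiftEquiv (cvM d L mv kk hL) (L ^ kk) μ x))ᴴ) (u k x * U μ x * (u k (bshiftEquiv (cvM d L mv kk hL) (L ^ kk) μ x))ᴴ)ᴴ))) + NV k ∘ₗ projO none) ∘ₗ mulOp (fun q : (CvX d L mv kk hL × ι) × Option (Fin (d + 1) ⊕ Fin (d + 1)) => cvChi d L mv kk hL k q.1.1)) ∘ₗ stack LinearMap.id (fun j => Sum.elim (fun μ => fgrad η⁻¹ (liftEquiv (bshiftEquiv (cvM d L mv kk hL) (L ^ kk) μ) ι)) (fun μ => bgrad η⁻¹ (liftEquiv (bshiftEquiv (cvM d L mv kk hL) (L ^ kk) μ) ι)) j)) ∘ₗ (projO none ∘ₗ bgPropV (stack (mulOp (fun p : CvX d L mv kk hL × ι => cvBump d L mv kk hL k p.1) ∘ₗ cvCube d L mv kk hL a ι k) (fun j => Sum.elim (fun μ => fgrad η⁻¹ (liftEquiv (bshiftEquiv (cvM d L mv kk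 hL) (L ^ kk) μ) ι)) (fun μ => bgrad η⁻¹ (liftEquiv (bshiftEquiv (cvM d L mv kk hL) (L ^ kk) μ) ι)) j ∘ₗ (mulOp (fun p : CvX d L mv kk hL × ι => cvBump d L mv kk hL k p.1) ∘ₗ cvCube d L mv kk hL a ι k))) (mulOp (fun p : CvX d L mv kk hL × ι => cvPsi d L mv kk hL k p.1) ∘ₗ (unstackM (tCoefC η (gaugePair (bshiftEquiv (cvM d L mv kk hL) (L ^ kk)) fun μ x => coordMat e (ContinuousLinearMap.mulLeftRight ℝ (Matrix mm mm ℂ) (u k x * U μ x * (u k (bshiftEquiv (cvM d L mv kk hL) (L ^ kk) μ x))ᴴ) (u k x * U μ x * (u k (bshiftEquiv (cvM d L mv kk hL) (L ^ kk) μ x))ᴴ)ᴴ)))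
  (tCoefA η (gaugePair (bshiftEquiv (cvM d L mv kk hL) (L ^ kk)) fun μ x => coordMat e (ContinuousLinearMap.mulLeftRight ℝ (Matrix mm mm ℂ) (u k x * U μ x * (u k (bshiftEquiv (cvM d L mv kk hL) (L ^ kk) μ x))ᴴ) (u k x * U μ x * (u k (bshiftEquiv (cvM d L mv kk hL) (L ^ kk) μ x))ᴴ)ᴴ))) + NV k ∘ₗ projO none) ∘ₗ mulOp (fun q : (CvX d L mv kk hL × ι) × Option (Fin (d + 1) ⊕ Fin (d + 1)) => cvChi d L mv kk hL k q.1.1)))) + mulOp (fun p : CvX d L mv kk hL × ι => knitH d L mv kk (L ^ kk) hL k p.1) ∘ₗ (-(((unstackM (tCoefC η (gaugePair (bshiftEquiv (cvM d L mv kk hL) (L ^ kk)) fun μ x => coordMat e (ContinuousLinearMap.mulLeftRight ℝ (Matrix mm mm ℂ) (u k x * U μ x * (u k (bshiftEquiv (cvM d L mv kk hL) (L ^ kk) μ x))ᴴ) (u k x * U μ x * (u k (bshiftEquiv (cvM d L mv kk hL) (L ^ kk) μ x))ᴴ)ᴴ)))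
  (tCoefA η (gaugePair (bshiftEquiv (cvM d L mv kk hL) (L ^ kk)) fun μ x => coordMat e (ContinuousLinearMap.mulLeftRight ℝ (Matrix mm mm ℂ) (u k x * U μ x * (u k (bshiftEquiv (cvM d L mv kk hL) (L ^ kk) μ x))ᴴ) (u k x * U μ x * (u k (bshiftEquiv (cvM d L mv kk hL) (L ^ kk) μ x))ᴴ)ᴴ))) + NV k ∘ₗ projO none) - mulOp (fun p : CvX d L mv kk hL × ι => cvPsi d L mv kk hL k p.1) ∘ₗ (unstackM (tCoefC η (gaugePair (bshiftEquiv (cvM d L mv kk hL) (L ^ kk)) fun μ x => coordMat e (ContinuousLinearMap.mulLeftRight ℝ (Matrix mm mm ℂ) (u k x * U μ x * (u k (bshiftEquiv (cvM d L mv kk hL) (L ^ kk) μ x))ᴴ) (u k x * U μ x * (u k (bshiftEquiv (cvM d L mv kk hL) (L ^ kk) μ x))ᴴ)ᴴ)))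
  (tCoefA η (gaugePair (bshiftEquiv (cvM d L mv kk hL) (L ^ kk)) fun μ x => coordMat e (ContinuousLinearMap.mulLeftRight ℝ (Matrix mm mm ℂ) (u k x * U μ x * (u k (bshiftEquiv (cvM d L mv kk hL) (L ^ kk) μ x))ᴴ) (u k x * U μ x * (u k (bshiftEquiv (cvM d L mv kk hL) (L ^ kk) μ x))ᴴ)ᴴ))) + NV k ∘ₗ projO none) ∘ₗ mulOp (fun q : (CvX d L mv kk hL × ι) × Option (Fin (d + 1) ⊕ Fin (d + 1)) => cvChi d L mv kk hL k q.1.1)) ∘ₗ stack LinearMap.id (fun j => Sum.elim (fun μ => fgrad η⁻¹ (liftEquiv (bshiftEquiv (cvM d L mv kk hL) (L ^ kk) μ) ι)) (fun μ => bgrad η⁻¹ (liftEquiv (bshiftEquiv (cvM d L mv kk hL) (L ^ kk) μ) ι)) j))) ∘ₗ (projO none ∘ₗ bgPropV (stack (mulOp (fun p : CvX d L mv kk hL × ι => cvBump d L mv kk hL k p.1) ∘ₗ cvCube d L mv kk hL a ι k) (fun j => Sum.elim (fun μ => fgrad η⁻¹ (liftEquiv (bshiftEquiv (cvM d L mv kk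 hL) (L ^ kk) μ) ι)) (fun μ => bgrad η⁻¹ (liftEquiv (bshiftEquiv (cvM d L mv kk hL) (L ^ kk) μ) ι)) j ∘ₗ (mulOp (fun p : CvX d L mv kk hL × ι => cvBump d L mv kk hL k p.1) ∘ₗ cvCube d L mv kk hL a ι k))) (mulOp (fun p : CvX d L mv kk hL × ι => cvPsi d L mv kk hL k p.1) ∘ₗ (unstackM (tCoefC η (gaugePair (bshiftEquiv (cvM d L mv kk hL) (L ^ kk)) fun μ x => coordMat e (ContinuousLinearMap.mulLeftRight ℝ (Matrix mm mm ℂ) (u k x * U μ x * (u k (bshiftEquiv (cvM d L mv kk hL) (L ^ kk) μ x))ᴴ) (u k x * U μ x * (u k (bshiftEquiv (cvM d L mv kk hL) (L ^ kk) μ x))ᴴ)ᴴ)))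
  (tCoefA η (gaugePair (bshiftEquiv (cvM d L mv kk hL) (L ^ kk)) fun μ x => coordMat e (ContinuousLinearMap.mulLeftRight ℝ (Matrix mm mm ℂ) (u k x * U μ x * (u k (bshiftEquiv (cvM d L mv kk hL) (L ^ kk) μ x))ᴴ) (u k x * U μ x * (u k (bshiftEquiv (cvM d L mv kk hL) (L ^ kk) μ x))ᴴ)ᴴ))) + NV k ∘ₗ projO none) ∘ₗ mulOp (fun q : (CvX d L mv kk hL × ι) × Option (Fin (d + 1) ⊕ Fin (d + 1)) => cvChi d L mv kk hL k q.1.1))))) ∘ₗ mmulOp (fun x => coordMat e (ContinuousLinearMap.mulLeftRight ℝ (Matrix mm mm ℂ) (u k x) (u k x)ᴴ))) ∘ₗ mulOp (fun p : CvX d L mv kk hL × ι => knitH d L mv kk (L ^ kk) hL k p.1))) OPERATOR OF THE DRESSED SMOOTH-CUT CUBES OF THE COVER FOR `Δ_{R_U} + P`** — dag-n15-w3 52's `glueInv (parametrix …) (remainder … − Σ_k …)` with the cover's data: partition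
`h_k` (FILE 70 `knitH`), cut `χ_k`, plateau `ψ_k`, bump `χ̃_k`, flat cubes `N_k`, flat nonlocal part `N_L`, shifts `bshiftEquiv`; per-cube unitary gauges `u_k` (`W_k = coordMat e Ad_{u_k}`),
the unitary bond field `U`, Bałaban's summand `P`, the nonlocal perturbations `N_V k`, spacing `η`. [cite: Balaban1985BackgroundPropagators, (3.62)–(3.65) pp.402–403, (3.76)–(3.77) p.406 (mechanism); Balaban1984PropagatorsII, (2.91) p.239, (2.133)–(2.136) p.247] -/
def cvGlued (mv kk : ℕ) (hL : Odd L ∧ 1 < L) (a η : ℝ) (ι : Type) [Fintype ι] [DecidableEq ι] {mm : Type} [Fintype mm] [DecidableEq mm] (e : Matrix mm mm ℂ ≃L[ℝ] (ι → ℝ))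
    (u : (Fin (d + 1) → ZMod (2 * L)) → CvX d L mv kk hL → Matrix mm mm ℂ) (U : Fin (d + 1) → CvX d L mv kk hL → Matrix mm mm ℂ)
    (P : (CvX d L mv kk hL × ι → ℝ) →ₗ[ℝ] (CvX d L mv kk hL × ι → ℝ)) (NV : (Fin (d + 1) → ZMod (2 * L)) → (CvX d L mv kk hL × ι → ℝ) →ₗ[ℝ] (CvX d L mv kk hL × ι → ℝ)) :
    (CvX d L mv kk hL × ι → ℝ) →ₗ[ℝ] (CvX d L mv kk hL × ι → ℝ) :=
  (glueInv (parametrix (fun k (p : CvX d L mv kk hL × ι) => knitH d L mv kk (L ^ kk) hL k p.1) (fun k => mmulOp (fun x => (coordMat e (ContinuousLinearMap.mulLeftRight ℝ (Matrix mm mm ℂ) (u k x) (u k x)ᴴ))ᵀ) ∘ₗ (projO none ∘ₗ bgPropV (stack (mulOp (fun p : CvX d L mv kk hL × ι => cvBump d L mv kk hL k p.1) ∘ₗ cvCube d L mv kk hL a ι k) (fun j => Sum.elim (fun μ => fgrad η⁻¹ (liftEquiv (bshiftEquiv (cvM d L mv kk hL) (L ^ kk) μ) ι)) (fun μ => bgrad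 η⁻¹ (liftEquiv (bshiftEquiv (cvM d L mv kk hL) (L ^ kk) μ) ι)) j ∘ₗ (mulOp (fun p : CvX d L mv kk hL × ι => cvBump d L mv kk hL k p.1) ∘ₗ cvCube d L mv kk hL a ι k))) (mulOp (fun p : CvX d L mv kk hL × ι => cvPsi d L mv kk hL k p.1) ∘ₗ (unstackM (tCoefC η (gaugePair (bshiftEquiv (cvM d L mv kk hL) (L ^ kk)) fun μ x => coordMat e (ContinuousLinearMap.mulLeftRight ℝ (Matrix mm mm ℂ) (u k x * U μ x * (u k (bshiftEquiv (cvM d L mv kk hL) (L ^ kk) μ x))ᴴ) (u k x * U μ x * (u k (bshiftEquiv (cvM d L mv kk hL) (L ^ kk) μ x))ᴴ)ᴴ)))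
  (tCoefA η (gaugePair (bshiftEquiv (cvM d L mv kk hL) (L ^ kk)) fun μ x => coordMat e (ContinuousLinearMap.mulLeftRight ℝ (Matrix mm mm ℂ) (u k x * U μ x * (u k (bshiftEquiv (cvM d L mv kk hL) (L ^ kk) μ x))ᴴ) (u k x * U μ x * (u k (bshiftEquiv (cvM d L mv kk hL) (L ^ kk) μ x))ᴴ)ᴴ))) + NV k ∘ₗ projO none) ∘ₗ mulOp (fun q : (CvX d L mv kk hL × ι) × Option (Fin (d + 1) ⊕ Fin (d + 1)) => cvChi d L mv kk hL k q.1.1))) ∘ₗ mmulOp (fun x => coordMat e (ContinuousLinearMap.mulLeftRight ℝ (Matrix mm mm ℂ) (u k x) (u k x)ᴴ))))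
  (remainder (covLapM (bshiftEquiv (cvM d L mv kk hL) (L ^ kk)) η (gaugePair (bshiftEquiv (cvM d L mv kk hL) (L ^ kk)) (fun μ x => coordMat e (ContinuousLinearMap.mulLeftRight ℝ (Matrix mm mm ℂ) (U μ x) (U μ x)ᴴ))) + P) (fun k (p : CvX d L mv kk hL × ι) => knitH d L mv kk (L ^ kk) hL k p.1) (fun k => mmulOp (fun x => (coordMat e (ContinuousLinearMap.mulLeftRight ℝ (Matrix mm mm ℂ) (u k x) (u k x)ᴴ))ᵀ) ∘ₗ (projO none ∘ₗ bgPropV (stack (mulOp (fun p : CvX d L mv kk hL × ι => cvBump d L mv kk hL k p.1) ∘ₗ cvCube d L mv kk hL a ι k) (fun j => Sum.elim (fun μ => fgrad η⁻¹ (liftEquiv (bshiftEquiv (cvM d L mv kk hL) (L ^ kk) μ) ι)) (fun μ => bgrad η⁻¹ (liftEquiv (bshiftEquiv (cvM d L mv kk hL) (L ^ kk) μ) ι)) j ∘ₗ (mulOp (fun p : CvX d L mv kk hL × ι => cvBump d L mv kk hL k p.1) ∘ₗ cvCube d L mv kk hL a ι k))) (mulOp (fun p : CvX d L mv kk hL ×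 ι => cvPsi d L mv kk hL k p.1) ∘ₗ (unstackM (tCoefC η (gaugePair (bshiftEquiv (cvM d L mv kk hL) (L ^ kk)) fun μ x => coordMat e (ContinuousLinearMap.mulLeftRight ℝ (Matrix mm mm ℂ) (u k x * U μ x * (u k (bshiftEquiv (cvM d L mv kk hL) (L ^ kk) μ x))ᴴ) (u k x * U μ x * (u k (bshiftEquiv (cvM d L mv kk hL) (L ^ kk) μ x))ᴴ)ᴴ)))
  (tCoefA η (gaugePair (bshiftEquiv (cvM d L mv kk hL) (L ^ kk)) fun μ x => coordMat e (ContinuousLinearMap.mulLeftRight ℝ (Matrix mm mm ℂ) (u k x * U μ x * (u k (bshiftEquiv (cvM d L mv kk hL) (L ^ kk) μ x))ᴴ) (u k x * U μ x * (u k (bshiftEquiv (cvM d L mv kk hL) (L ^ kk) μ x))ᴴ)ᴴ))) + NV k ∘ₗ projO none) ∘ₗ mulOp (fun q : (CvX d L mv kk hL × ι) × Option (Fin (d + 1) ⊕ Fin (d + 1)) => cvChi d L mv kk hL k q.1.1))) ∘ₗ mmulOp (fun x => coordMat e (ContinuousLinearMap.mulLeftRight ℝ (Matrix mm mm ℂ)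 (u k x) (u k x)ᴴ))) -
  ∑ k, (mmulOp (fun x => (coordMat e (ContinuousLinearMap.mulLeftRight ℝ (Matrix mm mm ℂ) (u k x) (u k x)ᴴ))ᵀ) ∘ₗ ((((-(mulOp (fun p : CvX d L mv kk hL × ι => knitH d L mv kk (L ^ kk) hL k p.1) ∘ₗ cvNL d L mv kk hL a ι ∘ₗ mulOp (1 - fun p : CvX d L mv kk hL × ι => cvBump d L mv kk hL k p.1))) ∘ₗ cvCube d L mv kk hL a ι k) ∘ₗ (LinearMap.id + ((mulOp (fun p : CvX d L mv kk hL × ι => cvPsi d L mv kk hL k p.1) ∘ₗ (unstackM (tCoefC η (gaugePair (bshiftEquiv (cvM d L mv kk hL) (L ^ kk)) fun μ x => coordMat e (ContinuousLinearMap.mulLeftRight ℝ (Matrix mm mm ℂ) (u k x * U μ x * (u k (bshiftEquiv (cvM d L mv kk hL) (L ^ kk) μ x))ᴴ) (u k x * U μ x * (u k (bshiftEquiv (cvM d L mv kk hL) (L ^ kk) μ x))ᴴ)ᴴ)))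
  (tCoefA η (gaugePair (bshiftEquiv (cvM d L mv kk hL) (L ^ kk)) fun μ x => coordMat e (ContinuousLinearMap.mulLeftRight ℝ (Matrix mm mm ℂ) (u k x * U μ x * (u k (bshiftEquiv (cvM d L mv kk hL) (L ^ kk) μ x))ᴴ) (u k x * U μ x * (u k (bshiftEquiv (cvM d L mv kk hL) (L ^ kk) μ x))ᴴ)ᴴ))) + NV k ∘ₗ projO none) ∘ₗ mulOp (fun q : (CvX d L mv kk hL × ι) × Option (Fin (d + 1) ⊕ Fin (d + 1)) => cvChi d L mv kk hL k q.1.1)) ∘ₗ stack LinearMap.id (fun j => Sum.elim (fun μ => fgrad η⁻¹ (liftEquiv (bshiftEquiv (cvM d L mv kk hL) (L ^ kk) μ) ι)) (fun μ => bgrad η⁻¹ (liftEquiv (bshiftEquiv (cvM d L mv kk hL) (L ^ kk) μ) ι)) j)) ∘ₗ (projO none ∘ₗ bgPropV (stack (mulOp (fun p : CvX d L mv kk hL × ι => cvBump d L mv kk hL k p.1) ∘ₗ cvCube d L mv kk hL a ι k) (fun j => Sum.elim (fun μ => fgrad η⁻¹ (liftEquiv (bshiftEquiv (cvM d L mv kk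 hL) (L ^ kk) μ) ι)) (fun μ => bgrad η⁻¹ (liftEquiv (bshiftEquiv (cvM d L mv kk hL) (L ^ kk) μ) ι)) j ∘ₗ (mulOp (fun p : CvX d L mv kk hL × ι => cvBump d L mv kk hL k p.1) ∘ₗ cvCube d L mv kk hL a ι k))) (mulOp (fun p : CvX d L mv kk hL × ι => cvPsi d L mv kk hL k p.1) ∘ₗ (unstackM (tCoefC η (gaugePair (bshiftEquiv (cvM d L mv kk hL) (L ^ kk)) fun μ x => coordMat e (ContinuousLinearMap.mulLeftRight ℝ (Matrix mm mm ℂ) (u k x * U μ x * (u k (bshiftEquiv (cvM d L mv kk hL) (L ^ kk) μ x))ᴴ) (u k x * U μ x * (u k (bshiftEquiv (cvM d L mv kk hL) (L ^ kk) μ x))ᴴ)ᴴ)))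
  (tCoefA η (gaugePair (bshiftEquiv (cvM d L mv kk hL) (L ^ kk)) fun μ x => coordMat e (ContinuousLinearMap.mulLeftRight ℝ (Matrix mm mm ℂ) (u k x * U μ x * (u k (bshiftEquiv (cvM d L mv kk hL) (L ^ kk) μ x))ᴴ) (u k x * U μ x * (u k (bshiftEquiv (cvM d L mv kk hL) (L ^ kk) μ x))ᴴ)ᴴ))) + NV k ∘ₗ projO none) ∘ₗ mulOp (fun q : (CvX d L mv kk hL × ι) × Option (Fin (d + 1) ⊕ Fin (d + 1)) => cvChi d L mv kk hL k q.1.1)))) + mulOp (fun p : CvX d L mv kk hL × ι => knitH d L mv kk (L ^ kk) hL k p.1) ∘ₗ (-(((unstackM (tCoefC η (gaugePair (bshiftEquiv (cvM d L mv kk hL) (L ^ kk)) fun μ x => coordMat e (ContinuousLinearMap.mulLeftRight ℝ (Matrix mm mm ℂ) (u k x * U μ x * (u k (bshiftEquiv (cvM d L mv kk hL) (L ^ kk) μ x))ᴴ) (u k x * U μ x * (u k (bshiftEquiv (cvM d L mv kk hL) (L ^ kk) μ x))ᴴ)ᴴ)))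
  (tCoefA η (gaugePair (bshiftEquiv (cvM d L mv kk hL) (L ^ kk)) fun μ x => coordMat e (ContinuousLinearMap.mulLeftRight ℝ (Matrix mm mm ℂ) (u k x * U μ x * (u k (bshiftEquiv (cvM d L mv kk hL) (L ^ kk) μ x))ᴴ) (u k x * U μ x * (u k (bshiftEquiv (cvM d L mv kk hL) (L ^ kk) μ x))ᴴ)ᴴ))) + NV k ∘ₗ projO none) - mulOp (fun p : CvX d L mv kk hL × ι => cvPsi d L mv kk hL k p.1) ∘ₗ (unstackM (tCoefC η (gaugePair (bshiftEquiv (cvM d L mv kk hL) (L ^ kk)) fun μ x => coordMat e (ContinuousLinearMap.mulLeftRight ℝ (Matrix mm mm ℂ) (u k x * U μ x * (u k (bshiftEquiv (cvM d L mv kk hL) (L ^ kk) μ x))ᴴ) (u k x * U μ x * (u k (bshiftEquiv (cvM d L mv kk hL) (L ^ kk) μ x))ᴴ)ᴴ)))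
  (tCoefA η (gaugePair (bshiftEquiv (cvM d L mv kk hL) (L ^ kk)) fun μ x => coordMat e (ContinuousLinearMap.mulLeftRight ℝ (Matrix mm mm ℂ) (u k x * U μ x * (u k (bshiftEquiv (cvM d L mv kk hL) (L ^ kk) μ x))ᴴ) (u k x * U μ x * (u k (bshiftEquiv (cvM d L mv kk hL) (L ^ kk) μ x))ᴴ)ᴴ))) + NV k ∘ₗ projO none) ∘ₗ mulOp (fun q : (CvX d L mv kk hL × ι) × Option (Fin (d + 1) ⊕ Fin (d + 1)) => cvChi d L mv kk hL k q.1.1)) ∘ₗ stack LinearMap.id (fun j => Sum.elim (fun μ => fgrad η⁻¹ (liftEquiv (bshiftEquiv (cvM d L mv kk hL) (L ^ kk) μ) ι)) (fun μ => bgrad η⁻¹ (liftEquiv (bshiftEquiv (cvM d L mv kk hL) (L ^ kk) μ) ι)) j))) ∘ₗ (projO none ∘ₗ bgPropV (stack (mulOp (fun p : CvX d L mv kk hL × ι => cvBump d L mv kk hL k p.1) ∘ₗ cvCube d L mv kk hL a ι k) (fun j => Sum.elim (fun μ => fgrad η⁻¹ (liftEquiv (bshiftEquiv (cvM d L mv kk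 hL) (L ^ kk) μ) ι)) (fun μ => bgrad η⁻¹ (liftEquiv (bshiftEquiv (cvM d L mv kk hL) (L ^ kk) μ) ι)) j ∘ₗ (mulOp (fun p : CvX d L mv kk hL × ι => cvBump d L mv kk hL k p.1) ∘ₗ cvCube d L mv kk hL a ι k))) (mulOp (fun p : CvX d L mv kk hL × ι => cvPsi d L mv kk hL k p.1) ∘ₗ (unstackM (tCoefC η (gaugePair (bshiftEquiv (cvM d L mv kk hL) (L ^ kk)) fun μ x => coordMat e (ContinuousLinearMap.mulLeftRight ℝ (Matrix mm mm ℂ) (u k x * U μ x * (u k (bshiftEquiv (cvM d L mv kk hL) (L ^ kk) μ x))ᴴ) (u k x * U μ x * (u k (bshiftEquiv (cvM d L mv kk hL) (L ^ kk) μ x))ᴴ)ᴴ)))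
  (tCoefA η (gaugePair (bshiftEquiv (cvM d L mv kk hL) (L ^ kk)) fun μ x => coordMat e (ContinuousLinearMap.mulLeftRight ℝ (Matrix mm mm ℂ) (u k x * U μ x * (u k (bshiftEquiv (cvM d L mv kk hL) (L ^ kk) μ x))ᴴ) (u k x * U μ x * (u k (bshiftEquiv (cvM d L mv kk hL) (L ^ kk) μ x))ᴴ)ᴴ))) + NV k ∘ₗ projO none) ∘ₗ mulOp (fun q : (CvX d L mv kk hL × ι) × Option (Fin (d + 1) ⊕ Fin (d + 1)) => cvChi d L mv kk hL k q.1.1))))) ∘ₗ mmulOp (fun x => coordMat e (ContinuousLinearMap.mulLeftRight ℝ (Matrix mm mm ℂ) (u k x) (u k x)ᴴ))) ∘ₗ mulOp (fun p : CvX d L mv kk hL × ι => knitH d L mv kk (L ^ kk) hL k p.1)))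

end Objects


/-! ## §3 The smallness of 52's remainder letter at the cover: every term is `O(w⁻¹)` except the far `N_V` letter -/

section Small
set_option maxHeartbeats 400000 in
/-- ★★ **52's `hq'` AT THE COVER**: with the cover's letters `c_t = c₁ = π∕w`, `c₂ = 32π²∕w²`, `ℓ = ω = πD∕w` (`D = d+1`), `d₁ = 1`, `θ_W = 0`, `c_N = (πD∕w·E′ + 2πD∕w)c_{N,0}`, a tail letter
`ε₀ ≤ κ∕w`, the small-field letter with `(β + β₁ + (π∕w)β)Rc_r² ≤ ½` and the far letter with `N_ov c_r·θ_F·2(β + β₁ + πβ)·c_r ≤ ¼`: the remainder letter is `< 1` as soon as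
`w ≥ 4N_ov c_r|ι|²(A₁ + A₂ + 2κ)` — pure real arithmetic. [cite: Balaban1984PropagatorsII, (2.134)–(2.135) p.247 («O(M⁻¹)»: shape)] -/
theorem cvSmall {Nov cr cι2 cJ β β₁ w R θF ε₀ ε E' cN₀ D κ : ℝ} (hNov : 0 ≤ Nov) (hcr : 0 ≤ cr) (hcι : 0 ≤ cι2) (hcJ : 0 ≤ cJ) (hβ : 0 ≤ β) (hβ₁ : 0 ≤ β₁) (hw : 1 ≤ w)
    (hR : 0 ≤ R) (hθF : 0 ≤ θF) (hε : 0 < ε) (hE' : 0 ≤ E') (hcN₀ : 0 ≤ cN₀) (hD : 0 ≤ D) (hκ : 0 ≤ κ)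
    (hq₀ : (β + (β₁ + π / w * β)) * (R * cr) * cr ≤ 1 / 2) (hθ : Nov * cr * (cι2 * (θF * (2 * (β + (β₁ + π * β))) * cr)) ≤ 1 / 4) (hε₀w : ε₀ ≤ κ / w)
    (hW : 4 * (Nov * cr * (cι2 * ((cJ * (32 * π ^ 2 * (2 * (β + (β₁ + π * β))) + 2 * (π * (2 * (β + (β₁ + π * β))))) + (π * D * E' + 2 * (π * D)) * cN₀ * (2 * (β + (β₁ + π * β))) * cr) +
      ((π * D * (Real.exp 1 * ε)⁻¹ + 2 * (π * D + π * D * 1)) * R * (2 * (β + (β₁ + π * β))) * cr + R * π * (2 * (β + (β₁ + π * β))) * cr) + 2 * κ))) ≤ w) :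
    Nov * (cι2 * (((cJ * ((32 * π ^ 2 / w ^ 2) * ((β + (β₁ + (π / w) * β)) * (1 - (β + (β₁ + (π / w) * β)) * (R * cr) * cr)⁻¹) + 2 * ((π / w) * ((β + (β₁ + (π / w) * β)) * (1 - (β + (β₁ + (π / w) * β)) * (R * cr) * cr)⁻¹))) + (0:ℝ) + ((π * D / w * E' + 2 * (π * D / w)) * cN₀) * ((β + (β₁ + (π / w) * β)) * (1 - (β + (β₁ + (π / w) * β)) * (R * cr) * cr)⁻¹) * cr)
          + (((π * D / w) * (Real.exp 1 * ε)⁻¹ + 2 * ((π * D / w) + (π * D / w) * (1:ℝ))) * R * ((β + (β₁ + (π / w) * β)) * (1 - (β + (β₁ + (π / w) * β)) * (R * cr) * cr)⁻¹) * cr + R * (π / w) * ((β + (β₁ + (π / w) * β)) * (1 - (β + (β₁ + (π / w) * β)) * (R * cr) * cr)⁻¹) * cr)) + (θF * (1 * ((β + (β₁ + (π / w) * β)) * (1 - (β + (β₁ + (π / w) * β)) * (R * cr) * cr)⁻¹)) * cr)) + cι2 * ((ε₀ * (1 - (β + (β₁ + (π / w) * β)) * (R * cr) * cr)⁻¹)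 + 0)) * cr < 1 ∧
    Nov * (cι2 * ((β + (β₁ + (π / w) * β)) * (1 - (β + (β₁ + (π / w) * β)) * (R * cr) * cr)⁻¹)) * (1 - (Nov * (cι2 * (((cJ * ((32 * π ^ 2 / w ^ 2) * ((β + (β₁ + (π / w) * β)) * (1 - (β + (β₁ + (π / w) * β)) * (R * cr) * cr)⁻¹) + 2 * ((π / w) * ((β + (β₁ + (π / w) * β)) * (1 - (β + (β₁ + (π / w) * β)) * (R * cr) * cr)⁻¹))) + (0:ℝ) + ((π * D / w * E' + 2 * (π * D / w)) * cN₀) * ((β + (β₁ + (π / w) * β)) * (1 - (β + (β₁ + (π / w) * β)) * (R * cr) * cr)⁻¹) * cr)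
          + (((π * D / w) * (Real.exp 1 * ε)⁻¹ + 2 * ((π * D / w) + (π * D / w) * (1:ℝ))) * R * ((β + (β₁ + (π / w) * β)) * (1 - (β + (β₁ + (π / w) * β)) * (R * cr) * cr)⁻¹) * cr + R * (π / w) * ((β + (β₁ + (π / w) * β)) * (1 - (β + (β₁ + (π / w) * β)) * (R * cr) * cr)⁻¹) * cr)) + (θF * (1 * ((β + (β₁ + (π / w) * β)) * (1 - (β + (β₁ + (π / w) * β)) * (R * cr) * cr)⁻¹)) * cr)) + cι2 * ((ε₀ * (1 - (β + (β₁ + (π / w) * β)) * (R * cr) * cr)⁻¹) + 0)) * cr))⁻¹ * cr ≤ Nov * (cι2 * (2 * (β + (β₁ + π * β)))) * 2 * cr := by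
  have hw0 : 0 < w := by linarith
  -- the resummation factor `(1 − q₀)⁻¹ ≤ 2` and the cube letter `B ≤ B̄ = 2(β + β₁ + πβ)`
  set q₀ : ℝ := (β + (β₁ + (π / w) * β)) * (R * cr) * cr with hq₀def
  have hinv : (1 - q₀)⁻¹ ≤ 2 := by
    calc (1 - q₀)⁻¹ ≤ (1 / 2)⁻¹ := inv_anti₀ (by norm_num) (by linarith)
      _ = 2 := by norm_num
  have hinv0 : 0 ≤ (1 - q₀)⁻¹ := inv_nonneg.mpr (by linarith)
  have hπw : π / w ≤ π := div_le_self pi_pos.le hw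
  have hβs : β + (β₁ + (π / w) * β) ≤ β + (β₁ + π * β) := by
    have := mul_le_mul_of_nonneg_right hπw hβ
    linarith
  have hβs0 : 0 ≤ β + (β₁ + (π / w) * β) := by positivity
  set B : ℝ := (β + (β₁ + (π / w) * β)) * (1 - q₀)⁻¹ with hBdef
  set Bb : ℝ := 2 * (β + (β₁ + π * β)) with hBbdef
  have hB0 : 0 ≤ B := mul_nonneg hβs0 hinv0
  have hB : B ≤ Bb := by
    calc B ≤ (β + (β₁ + π * β)) * 2 := mul_le_mul hβs hinv hinv0 (by positivity)
      _ = Bb := by rw [hBbdef]; ring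
  have hBb0 : 0 ≤ Bb := by positivity
  -- the four pieces
  have hc₂ : 32 * π ^ 2 / w ^ 2 ≤ 32 * π ^ 2 / w := div_le_div_of_nonneg_left (by positivity) hw0 (by nlinarith)
  have hT1 : cJ * ((32 * π ^ 2 / w ^ 2) * B + 2 * ((π / w) * B)) + (0:ℝ) + ((π * D / w * E' + 2 * (π * D / w)) * cN₀) * B * cr ≤
      cJ * (32 * π ^ 2 / w * Bb + 2 * (π / w * Bb)) + 0 + ((π * D / w * E' + 2 * (π * D / w)) * cN₀) * Bb * cr := by
    have h1 : 32 * π ^ 2 / w ^ 2 * B ≤ 32 * π ^ 2 / w * Bb := mul_le_mul hc₂ hB hB0 (by positivity)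
    have h2 : π / w * B ≤ π / w * Bb := mul_le_mul_of_nonneg_left hB (by positivity)
    have h3 : ((π * D / w * E' + 2 * (π * D / w)) * cN₀) * B * cr ≤ ((π * D / w * E' + 2 * (π * D / w)) * cN₀) * Bb * cr :=
      mul_le_mul_of_nonneg_right (mul_le_mul_of_nonneg_left hB (by positivity)) hcr
    have h12 : cJ * ((32 * π ^ 2 / w ^ 2) * B + 2 * ((π / w) * B)) ≤ cJ * (32 * π ^ 2 / w * Bb + 2 * (π / w * Bb)) := mul_le_mul_of_nonneg_left (by linarith) hcJ
    linarith
  have hT2 : ((π * D / w) * (Real.exp 1 * ε)⁻¹ + 2 * ((π * D / w) + (π * D / w) * (1:ℝ))) * R * B * cr + R * (π / w) * B * cr ≤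
      ((π * D / w) * (Real.exp 1 * ε)⁻¹ + 2 * ((π * D / w) + (π * D / w) * (1:ℝ))) * R * Bb * cr + R * (π / w) * Bb * cr := by
    have hE0 : 0 ≤ (Real.exp 1 * ε)⁻¹ := by positivity
    have h1 : ((π * D / w) * (Real.exp 1 * ε)⁻¹ + 2 * ((π * D / w) + (π * D / w) * (1:ℝ))) * R * B * cr ≤ ((π * D / w) * (Real.exp 1 * ε)⁻¹ + 2 * ((π * D / w) + (π * D / w) * (1:ℝ))) * R * Bb * cr :=
      mul_le_mul_of_nonneg_right (mul_le_mul_of_nonneg_left hB (by positivity)) hcr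
    have h2 : R * (π / w) * B * cr ≤ R * (π / w) * Bb * cr := mul_le_mul_of_nonneg_right (mul_le_mul_of_nonneg_left hB (by positivity)) hcr
    linarith
  have hT3 : θF * (1 * B) * cr ≤ θF * (1 * Bb) * cr := mul_le_mul_of_nonneg_right (mul_le_mul_of_nonneg_left (by linarith) hθF) hcr
  have hT4 : ε₀ * (1 - q₀)⁻¹ + 0 ≤ 2 * κ / w := by
    have := mul_le_mul hε₀w hinv hinv0 (by positivity : 0 ≤ κ / w)
    rw [add_zero]
    calc ε₀ * (1 - q₀)⁻¹ ≤ κ / w * 2 := this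
      _ = 2 * κ / w := by ring
  -- the `w⁻¹` pieces as ONE fraction
  set A₁ : ℝ := cJ * (32 * π ^ 2 * Bb + 2 * (π * Bb)) + (π * D * E' + 2 * (π * D)) * cN₀ * Bb * cr with hA₁
  set A₂ : ℝ := (π * D * (Real.exp 1 * ε)⁻¹ + 2 * (π * D + π * D * 1)) * R * Bb * cr + R * π * Bb * cr with hA₂
  have eT1 : cJ * (32 * π ^ 2 / w * Bb + 2 * (π / w * Bb)) + 0 + ((π * D / w * E' + 2 * (π * D / w)) * cN₀) * Bb * cr = A₁ / w := by
    rw [hA₁]; field_simp; ring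
  have eT2 : ((π * D / w) * (Real.exp 1 * ε)⁻¹ + 2 * ((π * D / w) + (π * D / w) * (1:ℝ))) * R * Bb * cr + R * (π / w) * Bb * cr = A₂ / w := by
    rw [hA₂]; field_simp
  have hA₁0 : 0 ≤ A₁ := by positivity
  have hA₂0 : 0 ≤ A₂ := by positivity
  -- assemble
  have hsum : Nov * (cι2 * (((cJ * ((32 * π ^ 2 / w ^ 2) * B + 2 * ((π / w) * B)) + (0:ℝ) + ((π * D / w * E' + 2 * (π * D / w)) * cN₀) * B * cr)
          + (((π * D / w) * (Real.exp 1 * ε)⁻¹ + 2 * ((π * D / w) + (π * D / w) * (1:ℝ))) * R * B * cr + R * (π / w) * B * cr)) + (θF * (1 * B) * cr)) + cι2 * ((ε₀ * (1 - q₀)⁻¹) + 0)) * cr ≤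
      Nov * (cι2 * ((A₁ / w + A₂ / w) + θF * (1 * Bb) * cr) + cι2 * (2 * κ / w)) * cr := by
    have hin : ((cJ * ((32 * π ^ 2 / w ^ 2) * B + 2 * ((π / w) * B)) + (0:ℝ) + ((π * D / w * E' + 2 * (π * D / w)) * cN₀) * B * cr)
          + (((π * D / w) * (Real.exp 1 * ε)⁻¹ + 2 * ((π * D / w) + (π * D / w) * (1:ℝ))) * R * B * cr + R * (π / w) * B * cr)) ≤ A₁ / w + A₂ / w := by
      rw [← eT1, ← eT2]
      exact add_le_add hT1 hT2
    have hin3 : cι2 * (((cJ * ((32 * π ^ 2 / w ^ 2) * B + 2 * ((π / w) * B)) + (0:ℝ) + ((π * D / w * E' + 2 * (π * D / w)) * cN₀) * B * cr)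
          + (((π * D / w) * (Real.exp 1 * ε)⁻¹ + 2 * ((π * D / w) + (π * D / w) * (1:ℝ))) * R * B * cr + R * (π / w) * B * cr)) + (θF * (1 * B) * cr)) ≤ cι2 * ((A₁ / w + A₂ / w) + θF * (1 * Bb) * cr) := mul_le_mul_of_nonneg_left (add_le_add hin hT3) hcι
    have hin4 : cι2 * ((ε₀ * (1 - q₀)⁻¹) + 0) ≤ cι2 * (2 * κ / w) := mul_le_mul_of_nonneg_left hT4 hcι
    exact mul_le_mul_of_nonneg_right (mul_le_mul_of_nonneg_left (add_le_add hin3 hin4) hNov) hcr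
  have hfrac : Nov * (cι2 * (A₁ / w + A₂ / w) + cι2 * (2 * κ / w)) * cr ≤ 1 / 4 := by
    have e : Nov * (cι2 * (A₁ / w + A₂ / w) + cι2 * (2 * κ / w)) * cr = Nov * cr * (cι2 * (A₁ + A₂ + 2 * κ)) / w := by
      field_simp
    rw [e, div_le_iff₀ hw0]
    linarith
  have hfar : Nov * (cι2 * (θF * (1 * Bb) * cr)) * cr ≤ 1 / 4 := by
    have e : Nov * (cι2 * (θF * (1 * Bb) * cr)) * cr = Nov * cr * (cι2 * (θF * Bb * cr)) := by ring
    rw [e]; exact hθ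
  have esplit : Nov * (cι2 * ((A₁ / w + A₂ / w) + θF * (1 * Bb) * cr) + cι2 * (2 * κ / w)) * cr =
      Nov * (cι2 * (A₁ / w + A₂ / w) + cι2 * (2 * κ / w)) * cr + Nov * (cι2 * (θF * (1 * Bb) * cr)) * cr := by ring
  have hE := hsum.trans (show Nov * (cι2 * ((A₁ / w + A₂ / w) + θF * (1 * Bb) * cr) + cι2 * (2 * κ / w)) * cr ≤ 1 / 2 by linarith)
  refine ⟨by linarith, ?_⟩
  have key : ∀ E : ℝ, E ≤ 1 / 2 → Nov * (cι2 * B) * (1 - E)⁻¹ * cr ≤ Nov * (cι2 * Bb) * 2 * cr := by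
    intro E hE'
    have h1E : (1 - E)⁻¹ ≤ 2 := by
      calc (1 - E)⁻¹ ≤ (1 / 2)⁻¹ := inv_anti₀ (by norm_num) (by linarith)
        _ = 2 := by norm_num
    have h1E0 : 0 ≤ (1 - E)⁻¹ := inv_nonneg.mpr (by linarith)
    have s1 : Nov * (cι2 * B) ≤ Nov * (cι2 * Bb) := mul_le_mul_of_nonneg_left (mul_le_mul_of_nonneg_left hB hcι) hNov
    exact mul_le_mul_of_nonneg_right (mul_le_mul s1 h1E h1E0 (by positivity)) hcr
  exact key _ hE

end Small


end Summit.QuantumFields.YangMills.BalabanUVNodes.N15.Gluing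

end
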